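import Summits.PneNP.PneNP.Theorems.KarlinRubinMonotoneSufficesRoomStars

/-!
# Crux `MonotoneSuffices` (stmt-PneNP-18026), the COVERING-DESIGN room theorem — part 2:
# the two per-`n` error counts of the detector on a FAMILY of `t`-sets

The covering-design detector accepts `x ∈ {0,1}^{E(Kₙ)}` iff some member `T i` of a fixed family
`T : Fin m → {t-sets of vertices}` has at least `θ` common neighbours outside it:
`D x = [∃ i, θ ≤ #{u ∉ T i : x ≡ 1 on star (T i) u}]`.
The two counts of the room theorem (part 2 there: `card_cnt_ge_le`, `cnt_plant_ge`) transfer verbatim: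

* `card_null_family_le` — `#{x : D x = 1} ≤ m · 2^{#E} · exp(-η² μ / 4)` whenever `(1+η) μ ≤ θ`,
  `μ = (n-t) 2^{-t}`, `0 ≤ η ≤ 2` (union bound over the `m` members instead of all `C(n,t)` `t`-sets);
* `card_planted_family_le` — if the planted set `A` CONTAINS some member `T i₀`, then
  `#{z : D (plant A z) = 0} ≤ 2^{#E} exp(-η² μ₁/4)` whenever `θ - (#A - t) - 1 ≤ (1-η) μ₁`,
  `μ₁ = (n - #A) 2^{-t}` (planted sets containing no member are handled by the averaging of part 1).

Counting only.
-/

set_option linter.dupNamespace false -- `Summit.PneNP.PneNP.…`: summit = sub-problem name (D-0017 single-conjunct layout)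

namespace Summit.PneNP.PneNP.Theorems.MonotoneSuffices.Cover

open Finset Real
open Literature.Probability.RandomGraphs.PlantedClique
open Summit.PneNP.PneNP.Theorems.MonotoneSuffices.Room

variable {n : ℕ}

/-- **Null count of the family detector.** If `(1+η) (n-t) 2^{-t} ≤ θ` with `0 ≤ η ≤ 2` and every member
of the family `T : Fin m → _` is a `t`-set, then
`#{x : ∃ i, θ ≤ cnt_{T i} x} ≤ m · 2^{#E} · exp(-η² (n-t) 2^{-t} / 4)`. [folklore] -/
theorem card_null_family_le {m : ℕ} (T : Fin m → Finset (Fin n)) (t θ : ℕ) (hT : ∀ i, #(T i) = t)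
    {η : ℝ} (hη : 0 ≤ η) (hη2 : η ≤ 2)
    (hθ : (1 + η) * (((n - t : ℕ) : ℝ) * (2 : ℝ)⁻¹ ^ t) ≤ θ) :
    (#(univ.filter fun x : EdgeVec n => ∃ i : Fin m,
        θ ≤ #((univ \ T i).filter fun u => ∀ e ∈ (univ.filter fun e : (⊤ : SimpleGraph (Fin n)).edgeSet =>
          ∃ w ∈ T i, (e : Sym2 (Fin n)) = s(u, w)), x e = true)) : ℝ) ≤
      (m : ℝ) * (2 ^ Fintype.card (⊤ : SimpleGraph (Fin n)).edgeSet *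
        Real.exp (-(η ^ 2 * (((n - t : ℕ) : ℝ) * (2 : ℝ)⁻¹ ^ t) / 4))) := by
  classical
  -- union bound over the members
  have hsub : (univ.filter fun x : EdgeVec n => ∃ i : Fin m,
      θ ≤ #((univ \ T i).filter fun u => ∀ e ∈ (univ.filter fun e : (⊤ : SimpleGraph (Fin n)).edgeSet =>
        ∃ w ∈ T i, (e : Sym2 (Fin n)) = s(u, w)), x e = true)) =
      (univ : Finset (Fin m)).biUnion fun i => univ.filter fun x : EdgeVec n =>
        θ ≤ #((univ \ T i).filter fun u => ∀ e ∈ (univ.filter fun e : (⊤ : SimpleGraph (Fin n)).edgeSet =>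
          ∃ w ∈ T i, (e : Sym2 (Fin n)) = s(u, w)), x e = true) := by
    ext x
    simp only [mem_filter, mem_univ, true_and, mem_biUnion]
  rw [hsub]
  refine (Nat.cast_le.2 card_biUnion_le).trans ?_
  push_cast
  have hi : ∀ i ∈ (univ : Finset (Fin m)),
      (#(univ.filter fun x : EdgeVec n =>
        θ ≤ #((univ \ T i).filter fun u => ∀ e ∈ (univ.filter fun e : (⊤ : SimpleGraph (Fin n)).edgeSet =>
          ∃ w ∈ T i, (e : Sym2 (Fin n)) = s(u, w)), x e = true)) : ℝ) ≤
      2 ^ Fintype.card (⊤ : SimpleGraph (Fin n)).edgeSet *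
        Real.exp (-(η ^ 2 * (((n - t : ℕ) : ℝ) * (2 : ℝ)⁻¹ ^ t) / 4)) := by
    intro i _
    have hUc : #(univ \ T i) = n - t := by rw [card_univ_sdiff, Fintype.card_fin, hT i]
    have h := card_cnt_ge_le (T i) (univ \ T i) (fun u hu => (mem_sdiff.1 hu).2) hη hη2
    rw [hT i, hUc] at h
    refine le_trans ?_ h
    exact_mod_cast card_le_card fun x hx => by
      simp only [mem_filter, mem_univ, true_and] at hx ⊢
      exact hθ.trans (by exact_mod_cast hx)
  refine (sum_le_sum hi).trans ?_
  rw [sum_const, card_univ, Fintype.card_fin, nsmul_eq_mul]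

/-- **Planted count of the family detector, for one planted set containing a member.** Let `T i₀ ⊆ A`
with all `#(T i) = t`, `0 ≤ η ≤ 2` and `θ - (#A - t) - 1 ≤ (1-η) (n - #A) 2^{-t}`. Then the inputs `z` whose
planted version `plant A z` is REJECTED number at most `2^{#E} exp(-η² (n - #A) 2^{-t} / 4)`. [folklore] -/
theorem card_planted_family_le {m : ℕ} (T : Fin m → Finset (Fin n)) (A : Finset (Fin n)) (i₀ : Fin m)
    (hA : T i₀ ⊆ A) (t θ : ℕ) (hT : ∀ i, #(T i) = t) {η : ℝ} (hη : 0 ≤ η) (hη2 : η ≤ 2)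
    (hθ : (θ : ℝ) - ((#A - t : ℕ) : ℝ) - 1 ≤ (1 - η) * (((n - #A : ℕ) : ℝ) * (2 : ℝ)⁻¹ ^ t)) :
    (#(univ.filter fun z : EdgeVec n => ¬ ∃ i : Fin m,
        θ ≤ #((univ \ T i).filter fun u => ∀ e ∈ (univ.filter fun e : (⊤ : SimpleGraph (Fin n)).edgeSet =>
          ∃ w ∈ T i, (e : Sym2 (Fin n)) = s(u, w)), plant A z e = true)) : ℝ) ≤
      2 ^ Fintype.card (⊤ : SimpleGraph (Fin n)).edgeSet *
        Real.exp (-(η ^ 2 * (((n - #A : ℕ) : ℝ) * (2 : ℝ)⁻¹ ^ t) / 4)) := by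
  classical
  have ht : #(T i₀) = t := hT i₀
  have hU : ∀ u ∈ univ \ A, u ∉ T i₀ := fun u hu h => (mem_sdiff.1 hu).2 (hA h)
  have h := card_filter_cnt_le_le_exp (E := (⊤ : SimpleGraph (Fin n)).edgeSet) (univ \ A)
    (fun u => univ.filter fun e : (⊤ : SimpleGraph (Fin n)).edgeSet => ∃ w ∈ T i₀, (e : Sym2 (Fin n)) = s(u, w)) t
    (fun u hu => (card_star (T i₀) (hU u hu)).trans ht) (pairwiseDisjoint_star (T i₀) (univ \ A) hU) hη hη2
  have hUc : #(univ \ A) = n - #A := by rw [card_univ_sdiff, Fintype.card_fin]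
  rw [hUc] at h
  refine le_trans ?_ h
  exact_mod_cast card_le_card fun z hz => by
    rw [mem_filter] at hz ⊢
    refine ⟨mem_univ _, ?_⟩
    obtain ⟨-, hz⟩ := hz
    have hlt : ¬ θ ≤ #((univ \ T i₀).filter fun u => ∀ e ∈ (univ.filter fun e : (⊤ : SimpleGraph (Fin n)).edgeSet =>
        ∃ w ∈ T i₀, (e : Sym2 (Fin n)) = s(u, w)), plant A z e = true) := fun h => hz ⟨i₀, h⟩
    have hge := cnt_plant_ge A (T i₀) hA z
    rw [card_sdiff_of_subset hA, ht] at hge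
    have hnat : #((univ \ A).filter fun u => ∀ e ∈ (univ.filter fun e : (⊤ : SimpleGraph (Fin n)).edgeSet =>
        ∃ w ∈ T i₀, (e : Sym2 (Fin n)) = s(u, w)), z e = true) + (#A - t) + 1 ≤ θ := by omega
    have hreal : (#((univ \ A).filter fun u => ∀ e ∈ (univ.filter fun e : (⊤ : SimpleGraph (Fin n)).edgeSet =>
        ∃ w ∈ T i₀, (e : Sym2 (Fin n)) = s(u, w)), z e = true) : ℝ) + ((#A - t : ℕ) : ℝ) + 1 ≤ θ := by
      exact_mod_cast hnat
    linarith

end Summit.PneNP.PneNP.Theorems.MonotoneSuffices.Cover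

namespace Summit.PneNP.PneNP.Theorems.MonotoneSuffices.Cover

open Finset

/-- Registered sub-goal `cover_stars` of stmt-PneNP-18026 (covering-design room theorem, part 2): the null count of
the family detector, exported verbatim. [folklore] -/
theorem cover_stars :
    ∀ {n m : ℕ} (T : Fin m → Finset (Fin n)) (t θ : ℕ), (∀ i, #(T i) = t) → ∀ {η : ℝ}, 0 ≤ η → η ≤ 2 → (1 + η) * (((n - t : ℕ) : ℝ) * (2 : ℝ)⁻¹ ^ t) ≤ θ → (#((Finset.univ : Finset (Literature.Probability.RandomGraphs.PlantedClique.EdgeVec n)).filter fun x => ∃ i : Fin m, θ ≤ #((Finset.univ \ T i).filter fun u => ∀ e ∈ (Finset.univ.filter fun e : (⊤ : SimpleGraph (Fin n)).edgeSet => ∃ w ∈ T i, (e : Sym2 (Fin n)) = s(u, w)), x e = true)) : ℝ) ≤ (m : ℝ) * (2 ^ Fintype.card (⊤ : SimpleGraph (Fin n)).edgeSet * Real.exp (-(η ^ 2 * (((n - t : ℕ) : ℝ) * (2 : ℝ)⁻¹ ^ t) / 4))) :=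
  fun T t θ hT _ hη hη2 hθ => card_null_family_le T t θ hT hη hη2 hθ

end Summit.PneNP.PneNP.Theorems.MonotoneSuffices.Cover
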